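import Summits.BirchSwinnertonDyer.BirchSwinnertonDyer.Theorems.ManinLocalTwoThreeEtaMonomialsFiftySix
import Summits.BirchSwinnertonDyer.BirchSwinnertonDyer.Theorems.ManinLocalTwoThreeNewformPinningFortyEight
import Summits.BirchSwinnertonDyer.BirchSwinnertonDyer.Theorems.ManinLocalTwoThreeCuspCoeffAsymptotics
import HarnessLib

/-!
# Level 56: the `η`-quotient cusp forms `P = η₄³η₁₄³/(η₂η₂₈)`, `Q = η₂³η₂₈³/(η₄η₁₄)`, their `q`-expansions and those of `φ₁₄` through
# `q¹⁵`, the genus `g(X₀(56)) = 5`, and the cuspidal Sturm bounds in weights `2` and `4`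

Cell bsd-f2-manin, route `ManinLocalTwoThree` (crux C2 `ManinOddAtFour`, stmt-22967: `2² ∣ 56`), prover seat p2 gen 28.  The two newforms of
level `56` are `56a = P − Q` and `56b = P + Q` (planner-an g51, turnkey T-an-g51-56, `HOME/an/g51/Sketch-an-g51-L56.lean`; certified to
`q²⁵⁹` there and to `q⁸⁴` in the seat folder, `scripts/level56.py`); this file supplies the kernel inputs of the fact-free pinning
`NewformPinningFiftySix` (next file) and of the `η`-identity files of the `X₀(56) → 56a1 / 56b1` programme:

* §1 `P`, `Q ∈ S₂(Γ₀(56))` by `EtaCert` (Newman's conditions; Ligozat orders `1,1,3,3,3,3,1,1` and `3,3,1,1,1,1,3,3` at the cusps `1/c`,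
  `c = 1, 2, 4, 7, 8, 14, 28, 56`);
* §2 `P = q + q³ − q⁵ − q⁹ − 2q¹¹ + q¹³ − 4q¹⁵ + o(q¹⁵)`, `Q = q³ − 3q⁵ + q⁷ + 2q⁹ + 2q¹¹ − q¹³ − 4q¹⁵ + o(q¹⁵)`,
  `φ₁₄ = q − q² − 2q³ + q⁴ + 2q⁶ + q⁷ − q⁸ + q⁹ − 2q¹² − 4q¹³ − q¹⁴ + o(q¹⁵)` (remainder calculus on the Euler truncations of
  `EulerRemaindersFiftySix`), hence the coefficient tables `aₙ(P)`, `aₙ(Q)`, `aₙ(φ₁₄)` at `n = 1, 2, 3, 4, 5, 9, 15` (`cuspCoeff_eq_coeff_of_tendsto`);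
* §3 `μ(Γ₀(56)) = 96`, `ν_∞ = 8`, `g(X₀(56)) = 5`, `dim S₂(Γ₀(56)) = 5`; the cuspidal Sturm bounds: `S ∈ S₂(Γ₀(56))` with `S = O(q¹⁰)` vanishes
  (`⌊2·96/12⌋ + 1 = 17 < 10 + 8`), `S ∈ S₄(Γ₀(56))` with `S = O(q²⁶)` vanishes (`33 < 26 + 8`).

No definition (the cusp forms `P`, `Q` enter as existence statements and as binders `(P) (hP : ⇑P = …)`), no named fact, no sorry.
Nothing here proves C2, Manin's conjecture or BSD. [cite: CremonaAlgorithms1997, Table 3 (N = 56)] [cite: DiamondShurman2005, Thm. 3.5.1, §3.8]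
-/

set_option autoImplicit false
-- lint-debt: the directory name repeats the summit name (sibling precedent `ManinLocalTwoThreeNewformPinningFortyEight.lean`)
set_option linter.dupNamespace false

noncomputable section

open Complex Filter Topology Set Asymptotics Polynomial
open UpperHalfPlane hiding I
open scoped Real Topology Manifold MatrixGroups ModularForm
open ModularForm CongruenceSubgroup SlashInvariantForm
open Literature.NumberTheory.ModularForms
open Literature.NumberTheory.EllipticCurves Literature.NumberTheory.EllipticCurves.ModularForms

namespace Summit.BirchSwinnertonDyer.BirchSwinnertonDyer.Theorems.ManinLocalTwoThree.NewformsFiftySix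

open QRemainder EulerRemainders EtaMonomialsFiftySix CuspCoeffAsymptotics

/-! ## §1 The cusp forms `P`, `Q` of level `56` -/

/-- Certificate: `P = η₄³η₁₄³/(η₂η₂₈)` is an `η`-quotient CUSP form of weight `2` on `Γ₀(56)` (Newman; Ligozat orders `1,1,3,3,3,3,1,1 > 0`;
`2·4³·14³·28 = 3136²`) (planner-an g51). [folklore] -/
theorem etaCert_P56 : EtaCert 56 [(2, -1), (4, 3), (14, 3), (28, -1)] 3136 := by
  decide

/-- Certificate: `Q = η₂³η₂₈³/(η₄η₁₄)` is an `η`-quotient CUSP form of weight `2` on `Γ₀(56)` (Newman; Ligozat orders `3,3,1,1,1,1,3,3 > 0`;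
`2³·4·14·28³ = 3136²`) (planner-an g51). [folklore] -/
theorem etaCert_Q56 : EtaCert 56 [(2, 3), (4, -1), (14, -1), (28, 3)] 3136 := by
  decide

/-- **`P = η₄³η₁₄³/(η₂η₂₈) ∈ S₂(Γ₀(56))`** (as an existence statement; no definition). [folklore] -/
theorem exists_cuspForm_P56 : ∃ P : CuspForm (Gamma0 56) 2, ⇑P = etaQuotient 56 (expFn [(2, -1), (4, 3), (14, 3), (28, -1)]) :=
  ⟨etaQuotientCuspForm 56 (expFn [(2, -1), (4, 3), (14, 3), (28, -1)]) 2 (by decide) (newmanCond_of_etaCert etaCert_P56)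
    etaCert_P56.2.2.2.2, rfl⟩

/-- **`Q = η₂³η₂₈³/(η₄η₁₄) ∈ S₂(Γ₀(56))`** (as an existence statement; no definition). [folklore] -/
theorem exists_cuspForm_Q56 : ∃ Q : CuspForm (Gamma0 56) 2, ⇑Q = etaQuotient 56 (expFn [(2, 3), (4, -1), (14, -1), (28, 3)]) :=
  ⟨etaQuotientCuspForm 56 (expFn [(2, 3), (4, -1), (14, -1), (28, 3)]) 2 (by decide) (newmanCond_of_etaCert etaCert_Q56)
    etaCert_Q56.2.2.2.2, rfl⟩

/-- The underlying function of the tree's `φ₁₄ = η₁η₂η₇η₁₄`. [folklore] -/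
theorem coe_cuspFormEta14' : (cuspFormEta14 : ℍ → ℂ) = etaQuotient 14 (expFn [(1, 1), (2, 1), (7, 1), (14, 1)]) := rfl

/-! ## §2 The `q`-expansions of `P`, `Q`, `φ₁₄` through `q¹⁵` and the coefficient tables -/

/-- **`P = η₄³η₁₄³/(η₂η₂₈)` `= q + q ^ 3 - q ^ 5 - q ^ 9 - 2 * q ^ 11 + q ^ 13 - 4 * q ^ 15 + o(q¹⁵)`.** [folklore] -/
theorem tendsto_P56_sub :
    Tendsto (fun τ : ℍ ↦ (etaQuotient 56 (expFn [(2, -1), (4, 3), (14, 3), (28, -1)]) τ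
      - (X + X ^ 3 - X ^ 5 - X ^ 9 - 2 * X ^ 11 + X ^ 13 - 4 * X ^ 15 : ℂ[X]).eval (Function.Periodic.qParam 1 (τ : ℂ)))
      / Function.Periodic.qParam 1 (τ : ℂ) ^ 15) atImInfty (𝓝 0) := by
  have h1 := EulerRemaindersTwenty.tendsto_mono (show 15 ≤ 32 by norm_num) EulerRemaindersFiftySix.tendsto_eulerFn_two_thirtyTwo
  have h2 := QRemainder.inv (1 + X ^ 2 + 2 * X ^ 4 + 3 * X ^ 6 + 5 * X ^ 8 + 7 * X ^ 10 + 11 * X ^ 12 + 15 * X ^ 14) (-22 - 8 * X ^ 2 + 10 * X ^ 4 + 16 * X ^ 6 + 21 * X ^ 8 + 10 * X ^ 10 + 13 * X ^ 12 - 4 * X ^ 14 - 6 * X ^ 16 - 9 * X ^ 18 - 14 * X ^ 20 - 20 * X ^ 22 - 7 * X ^ 24 - 11 * X ^ 26 - 15 * X ^ 28 : ℂ[X]) (by ring)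
    (fun τ ↦ eulerFn_ne_zero (by norm_num) τ) (by simp) h1
  have h3 := EulerRemaindersTwenty.tendsto_mono (show 15 ≤ 32 by norm_num) EulerRemaindersFiftySix.tendsto_eulerFn_four_thirtyTwo
  have h4 := QRemainder.reduce (1 - 3 * X ^ 4 + 5 * X ^ 12) (-7 * X ^ 8 + 9 * X ^ 24 + 3 * X ^ 32 - 6 * X ^ 36 - 3 * X ^ 40 - 2 * X ^ 44 - 3 * X ^ 48 + 3 * X ^ 52 + 3 * X ^ 60 + X ^ 68 : ℂ[X]) (by ring) (QRemainder.pow h3 3)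
  have h5 := QRemainder.reduce (1 + X ^ 2 - X ^ 4 - X ^ 8 - 2 * X ^ 10 + X ^ 12 - X ^ 14) (-23 - 30 * X ^ 2 + 25 * X ^ 4 + 35 * X ^ 6 + 55 * X ^ 8 + 75 * X ^ 10 : ℂ[X]) (by ring) (QRemainder.mul h2 h4)
  have h6 := EulerRemaindersTwenty.tendsto_mono (show 15 ≤ 32 by norm_num) EulerRemaindersFiftySix.tendsto_eulerFn_fourteen_thirtyTwo
  have h7 := QRemainder.reduce (1 - 3 * X ^ 14) (5 * X ^ 26 - 3 * X ^ 54 - X ^ 68 : ℂ[X]) (by ring) (QRemainder.pow h6 3)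
  have h8 := QRemainder.reduce (1 + X ^ 2 - X ^ 4 - X ^ 8 - 2 * X ^ 10 + X ^ 12 - 4 * X ^ 14) (-3 + 3 * X ^ 2 + 3 * X ^ 6 + 6 * X ^ 8 - 3 * X ^ 10 + 3 * X ^ 12 : ℂ[X]) (by ring) (QRemainder.mul h5 h7)
  have h9 := tendsto_eulerFn (δ := 28) (m := 15) (by norm_num)
  have h10 := QRemainder.inv (1) (0 : ℂ[X]) (by ring)
    (fun τ ↦ eulerFn_ne_zero (by norm_num) τ) (by simp) h9
  have h11 := QRemainder.mul h8 h10
  have h12 := QRemainder.qParam_pow_mul 1 h11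
  refine h12.congr fun τ ↦ ?_
  rw [P56_eq]
  ring

/-- **`Q = η₂³η₂₈³/(η₄η₁₄)` `= q ^ 3 - 3 * q ^ 5 + q ^ 7 + 2 * q ^ 9 + 2 * q ^ 11 - q ^ 13 - 4 * q ^ 15 + o(q¹⁵)`.** [folklore] -/
theorem tendsto_Q56_sub :
    Tendsto (fun τ : ℍ ↦ (etaQuotient 56 (expFn [(2, 3), (4, -1), (14, -1), (28, 3)]) τ
      - (X ^ 3 - 3 * X ^ 5 + X ^ 7 + 2 * X ^ 9 + 2 * X ^ 11 - X ^ 13 - 4 * X ^ 15 : ℂ[X]).eval (Function.Periodic.qParam 1 (τ : ℂ)))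
      / Function.Periodic.qParam 1 (τ : ℂ) ^ 15) atImInfty (𝓝 0) := by
  have h1 := EulerRemaindersTwenty.tendsto_mono (show 15 ≤ 32 by norm_num) EulerRemaindersFiftySix.tendsto_eulerFn_two_thirtyTwo
  have h2 := QRemainder.reduce (1 - 3 * X ^ 2 + 5 * X ^ 6 - 7 * X ^ 12) (9 * X ^ 4 - 11 * X ^ 14 + 13 * X ^ 26 - 3 * X ^ 28 + 6 * X ^ 30 + 3 * X ^ 32 - 6 * X ^ 34 - 6 * X ^ 36 - 6 * X ^ 40 - 6 * X ^ 42 + 3 * X ^ 44 + 3 * X ^ 48 + 6 * X ^ 52 + 3 * X ^ 54 - X ^ 56 + 3 * X ^ 58 - 3 * X ^ 62 - 3 * X ^ 68 - X ^ 74 : ℂ[X]) (by ring) (QRemainder.pow h1 3)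
  have h3 := EulerRemaindersTwenty.tendsto_mono (show 15 ≤ 32 by norm_num) EulerRemaindersFiftySix.tendsto_eulerFn_four_thirtyTwo
  have h4 := QRemainder.inv (1 + X ^ 4 + 2 * X ^ 8 + 3 * X ^ 12) (-5 - 2 * X ^ 4 + X ^ 8 + 3 * X ^ 12 + 4 * X ^ 16 + 2 * X ^ 20 + 3 * X ^ 24 : ℂ[X]) (by ring)
    (fun τ ↦ eulerFn_ne_zero (by norm_num) τ) (by simp) h3
  have h5 := QRemainder.reduce (1 - 3 * X ^ 2 + X ^ 4 + 2 * X ^ 6 + 2 * X ^ 8 - X ^ 10 - 4 * X ^ 12 + X ^ 14) (-7 + 15 * X ^ 2 - 14 * X ^ 4 - 21 * X ^ 8 : ℂ[X]) (by ring) (QRemainder.mul h2 h4)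
  have h6 := EulerRemaindersTwenty.tendsto_mono (show 15 ≤ 32 by norm_num) EulerRemaindersFiftySix.tendsto_eulerFn_fourteen_thirtyTwo
  have h7 := QRemainder.inv (1 + X ^ 14) (-2 * X ^ 12 - X ^ 26 : ℂ[X]) (by ring)
    (fun τ ↦ eulerFn_ne_zero (by norm_num) τ) (by simp) h6
  have h8 := QRemainder.reduce (1 - 3 * X ^ 2 + X ^ 4 + 2 * X ^ 6 + 2 * X ^ 8 - X ^ 10 - 4 * X ^ 12 + 2 * X ^ 14) (-3 + X ^ 2 + 2 * X ^ 4 + 2 * X ^ 6 - X ^ 8 - 4 * X ^ 10 + X ^ 12 : ℂ[X]) (by ring) (QRemainder.mul h5 h7)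
  have h9 := tendsto_eulerFn (δ := 28) (m := 15) (by norm_num)
  have h10 := QRemainder.pow h9 3
  have h11 := QRemainder.mul h8 h10
  have h12 := QRemainder.reduce (X ^ 3 - 3 * X ^ 5 + X ^ 7 + 2 * X ^ 9 + 2 * X ^ 11 - X ^ 13 - 4 * X ^ 15) (2 * X : ℂ[X]) (by ring) (QRemainder.qParam_pow_mul 3 h11)
  refine h12.congr fun τ ↦ ?_
  rw [Q56_eq]
  ring

/-- **`φ₁₄ = η₁η₂η₇η₁₄` `= q - q ^ 2 - 2 * q ^ 3 + q ^ 4 + 2 * q ^ 6 + q ^ 7 - q ^ 8 + q ^ 9 - 2 * q ^ 12 - 4 * q ^ 13 - q ^ 14 + o(q¹⁵)`.** [folklore] -/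
theorem tendsto_phi14_sub :
    Tendsto (fun τ : ℍ ↦ (etaQuotient 14 (expFn [(1, 1), (2, 1), (7, 1), (14, 1)]) τ
      - (X - X ^ 2 - 2 * X ^ 3 + X ^ 4 + 2 * X ^ 6 + X ^ 7 - X ^ 8 + X ^ 9 - 2 * X ^ 12 - 4 * X ^ 13 - X ^ 14 : ℂ[X]).eval (Function.Periodic.qParam 1 (τ : ℂ)))
      / Function.Periodic.qParam 1 (τ : ℂ) ^ 15) atImInfty (𝓝 0) := by
  have h1 := EtaMonomialsFiftySix.tendsto_eulerFn_one_fifteen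
  have h2 := EulerRemaindersTwenty.tendsto_mono (show 15 ≤ 32 by norm_num) EulerRemaindersFiftySix.tendsto_eulerFn_two_thirtyTwo
  have h3 := QRemainder.reduce (1 - X - 2 * X ^ 2 + X ^ 3 + 2 * X ^ 5 + X ^ 6 - 2 * X ^ 9 + X ^ 10 - 2 * X ^ 11 - 2 * X ^ 12 + 2 * X ^ 14 - X ^ 15) (2 * X + 2 * X ^ 3 + X ^ 5 - X ^ 6 - X ^ 8 - 2 * X ^ 13 - X ^ 14 + X ^ 16 - X ^ 19 + X ^ 20 - X ^ 21 + X ^ 23 + X ^ 26 + X ^ 29 : ℂ[X]) (by ring) (QRemainder.mul h1 h2)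
  have h4 := EtaMonomialsFiftySix.tendsto_eulerFn_seven_fifteen
  have h5 := QRemainder.reduce (1 - X - 2 * X ^ 2 + X ^ 3 + 2 * X ^ 5 + X ^ 6 - X ^ 7 + X ^ 8 - 2 * X ^ 11 - 4 * X ^ 12 - X ^ 13 + X ^ 14) (4 - 2 * X + 2 * X ^ 2 - X ^ 4 - 2 * X ^ 5 + X ^ 6 + 2 * X ^ 7 - X ^ 8 + 2 * X ^ 9 + 2 * X ^ 10 - 2 * X ^ 12 + X ^ 13 : ℂ[X]) (by ring) (QRemainder.mul h3 h4)
  have h6 := EulerRemaindersTwenty.tendsto_mono (show 15 ≤ 32 by norm_num) EulerRemaindersFiftySix.tendsto_eulerFn_fourteen_thirtyTwo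
  have h7 := QRemainder.reduce (1 - X - 2 * X ^ 2 + X ^ 3 + 2 * X ^ 5 + X ^ 6 - X ^ 7 + X ^ 8 - 2 * X ^ 11 - 4 * X ^ 12 - X ^ 13 + X ^ 15) (2 - X - 2 * X ^ 3 - X ^ 4 + X ^ 5 - X ^ 6 + 2 * X ^ 9 + 4 * X ^ 10 + X ^ 11 - 2 * X ^ 12 + X ^ 13 + 2 * X ^ 14 - X ^ 15 - 2 * X ^ 17 - X ^ 18 + X ^ 19 - X ^ 20 + 2 * X ^ 23 + 4 * X ^ 24 + X ^ 25 - X ^ 26 : ℂ[X]) (by ring) (QRemainder.mul h5 h6)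
  have h8 := QRemainder.reduce (X - X ^ 2 - 2 * X ^ 3 + X ^ 4 + 2 * X ^ 6 + X ^ 7 - X ^ 8 + X ^ 9 - 2 * X ^ 12 - 4 * X ^ 13 - X ^ 14) (1 : ℂ[X]) (by ring) (QRemainder.qParam_pow_mul 1 h7)
  refine h8.congr fun τ ↦ ?_
  rw [phi14_eq]
  ring

/-- **`aₙ(P56)` at `n = 1, 2, 3, 4, 5, 9, 15`: `1, 0, 1, 0, -1, -1, -4`.** [cite: CremonaAlgorithms1997, Table 3 (N = 56)] -/
theorem cuspCoeff_P56 (P : CuspForm (Gamma0 56) 2) (hP : ⇑P = etaQuotient 56 (expFn [(2, -1), (4, 3), (14, 3), (28, -1)])) :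
    cuspCoeff P 1 = 1 ∧ cuspCoeff P 2 = 0 ∧ cuspCoeff P 3 = 1 ∧ cuspCoeff P 4 = 0 ∧ cuspCoeff P 5 = -1 ∧ cuspCoeff P 9 = -1 ∧ cuspCoeff P 15 = -4 := by
  have h := cuspCoeff_eq_coeff_of_tendsto P (X + X ^ 3 - X ^ 5 - X ^ 9 - 2 * X ^ 11 + X ^ 13 - 4 * X ^ 15 : ℂ[X]) 15 (by compute_degree!)
    (by simpa only [hP] using tendsto_P56_sub)
  exact ⟨by rw [h 1 (by norm_num)]; simp [coeff_X], by rw [h 2 (by norm_num)]; simp [coeff_X], by rw [h 3 (by norm_num)]; simp [coeff_X], by rw [h 4 (by norm_num)]; simp [coeff_X], by rw [h 5 (by norm_num)]; simp [coeff_X], by rw [h 9 (by norm_num)]; simp [coeff_X], by rw [h 15 (by norm_num)]; simp [coeff_X]⟩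

/-- **`aₙ(Q56)` at `n = 1, 2, 3, 4, 5, 9, 15`: `0, 0, 1, 0, -3, 2, -4`.** [cite: CremonaAlgorithms1997, Table 3 (N = 56)] -/
theorem cuspCoeff_Q56 (Q : CuspForm (Gamma0 56) 2) (hQ : ⇑Q = etaQuotient 56 (expFn [(2, 3), (4, -1), (14, -1), (28, 3)])) :
    cuspCoeff Q 1 = 0 ∧ cuspCoeff Q 2 = 0 ∧ cuspCoeff Q 3 = 1 ∧ cuspCoeff Q 4 = 0 ∧ cuspCoeff Q 5 = -3 ∧ cuspCoeff Q 9 = 2 ∧ cuspCoeff Q 15 = -4 := by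
  have h := cuspCoeff_eq_coeff_of_tendsto Q (X ^ 3 - 3 * X ^ 5 + X ^ 7 + 2 * X ^ 9 + 2 * X ^ 11 - X ^ 13 - 4 * X ^ 15 : ℂ[X]) 15 (by compute_degree!)
    (by simpa only [hQ] using tendsto_Q56_sub)
  exact ⟨by rw [h 1 (by norm_num)]; simp, by rw [h 2 (by norm_num)]; simp, by rw [h 3 (by norm_num)]; simp, by rw [h 4 (by norm_num)]; simp, by rw [h 5 (by norm_num)]; simp, by rw [h 9 (by norm_num)]; simp, by rw [h 15 (by norm_num)]; simp⟩

/-- **`aₙ(phi14)` at `n = 1, 2, 3, 4, 5, 9, 15`: `1, -1, -2, 1, 0, 1, 0`.** [cite: CremonaAlgorithms1997, Table 3 (N = 56)] -/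
theorem cuspCoeff_phi14 :
    cuspCoeff cuspFormEta14 1 = 1 ∧ cuspCoeff cuspFormEta14 2 = -1 ∧ cuspCoeff cuspFormEta14 3 = -2 ∧ cuspCoeff cuspFormEta14 4 = 1 ∧ cuspCoeff cuspFormEta14 5 = 0 ∧ cuspCoeff cuspFormEta14 9 = 1 ∧ cuspCoeff cuspFormEta14 15 = 0 := by
  have h := cuspCoeff_eq_coeff_of_tendsto cuspFormEta14 (X - X ^ 2 - 2 * X ^ 3 + X ^ 4 + 2 * X ^ 6 + X ^ 7 - X ^ 8 + X ^ 9 - 2 * X ^ 12 - 4 * X ^ 13 - X ^ 14 : ℂ[X]) 15 (by compute_degree!)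
    (by simpa only [coe_cuspFormEta14'] using tendsto_phi14_sub)
  exact ⟨by rw [h 1 (by norm_num)]; simp [coeff_X], by rw [h 2 (by norm_num)]; simp [coeff_X], by rw [h 3 (by norm_num)]; simp [coeff_X], by rw [h 4 (by norm_num)]; simp [coeff_X], by rw [h 5 (by norm_num)]; simp [coeff_X], by rw [h 9 (by norm_num)]; simp [coeff_X], by rw [h 15 (by norm_num)]; simp [coeff_X]⟩

/-! ## §3 The genus of `X₀(56)` and the cuspidal Sturm bounds in weights `2` and `4` -/

/-- `μ(Γ₀(56)) = 96`, `ν_∞ = 8`, `ν₂ = ν₃ = 0` (planner-an g51). [cite: DiamondShurman2005, §3.8] -/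
theorem gamma0_data_56 : gamma0Index 56 = 96 ∧ nuInfty 56 = 8 ∧ nu₂ 56 = 0 ∧ nu₃ 56 = 0 := by
  refine ⟨(gamma0Index_mul (m := 8) (n := 7) (by norm_num)).trans ?_, by decide, by rw [nu₂_eq_card]; decide,
    by rw [nu₃_eq_card]; decide⟩
  rw [show (8 : ℕ) = 2 ^ 3 by norm_num, gamma0Index_prime_pow (p := 2) (e := 3) Nat.prime_two (by norm_num),
    show (7 : ℕ) = 7 ^ 1 by norm_num, gamma0Index_prime_pow (p := 7) (e := 1) (by norm_num) (by norm_num)]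
  norm_num

/-- `g(X₀(56)) = 5`. [cite: DiamondShurman2005, Thm. 3.1.1] -/
theorem genusX0_fiftySix : genusX0 56 = 5 := by
  obtain ⟨h1, h2, h3, h4⟩ := gamma0_data_56
  rw [genusX0, h1, h2, h3, h4]

/-- **`dim S₂(Γ₀(56)) = 5`.** [cite: DiamondShurman2005, Thm. 3.5.1] -/
theorem finrank_cuspForm_two_fiftySix : Module.finrank ℂ (CuspForm (Gamma0 56) 2) = 5 := by
  have h := finrank_cuspForm_two_eq_genusX0_holds 56
  unfold finrank_cuspForm_two_eq_genusX0 at h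
  rw [h, genusX0_fiftySix]

/-- `[SL₂(ℤ) : Γ₀(56)] = 96` and `#cusps(Γ₀(56)) = 8` in the currency of the tree's Sturm bound. [cite: DiamondShurman2005, §3.8] -/
theorem sturm_data_56 :
    Nat.card (𝒮ℒ ⧸ ((Gamma0 56 : Subgroup SL(2, ℤ)) : Subgroup (GL (Fin 2) ℝ)).subgroupOf 𝒮ℒ) = 96 ∧
      Nat.card (CuspOrbits ((Gamma0 56 : Subgroup SL(2, ℤ)) : Subgroup (GL (Fin 2) ℝ))) = 8 := by
  constructor
  · rw [card_quotient_subgroupOf_eq_index]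
    have h1 := index_gamma0_eq_gamma0Index_holds 56
    unfold index_gamma0_eq_gamma0Index at h1
    rw [h1, gamma0_data_56.1]
  · have h1 := numCusps_eq_nuInfty_holds 56
    unfold numCusps_eq_nuInfty numCusps at h1
    rw [h1, gamma0_data_56.2.1]

/-- `q^m = O(e^{−2πm Im τ})` (equality of norms). [folklore] -/
theorem qParam_pow_isBigO_exp (m : ℕ) :
    (fun τ : ℍ ↦ Function.Periodic.qParam 1 (τ : ℂ) ^ m) =O[atImInfty] fun τ : ℍ ↦ Real.exp (-2 * π * m * τ.im) := by
  refine Asymptotics.IsBigO.of_bound 1 (Filter.Eventually.of_forall fun τ ↦ ?_)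
  rw [norm_pow, Function.Periodic.norm_qParam, Real.norm_eq_abs, abs_of_pos (Real.exp_pos _), one_mul,
    ← Real.exp_nat_mul, UpperHalfPlane.coe_im]
  apply le_of_eq
  congr 1
  ring

/-- **`S ∈ S_k(Γ₀(56))` with `S/q^m` convergent at `i∞` is `O(e^{−2πm Im τ})`.** [folklore] -/
theorem isBigO_exp_of_tendsto_div_qParam_pow {k : ℤ} (S : CuspForm (Gamma0 56) k) (m : ℕ) {c : ℂ}
    (h : Tendsto (fun τ : ℍ ↦ S τ / Function.Periodic.qParam 1 (τ : ℂ) ^ m) atImInfty (𝓝 c)) :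
    (⇑S) =O[atImInfty] fun τ : ℍ ↦ Real.exp (-2 * π * m * τ.im) := by
  have h1 : (fun τ : ℍ ↦ S τ / Function.Periodic.qParam 1 (τ : ℂ) ^ m) =O[atImInfty] fun _ : ℍ ↦ (1 : ℝ) := h.isBigO_one ℝ
  have h3 := h1.mul (qParam_pow_isBigO_exp m)
  simp only [one_mul] at h3
  refine h3.congr' (Filter.Eventually.of_forall fun τ ↦ ?_) EventuallyEq.rfl
  have hq : Function.Periodic.qParam 1 (τ : ℂ) ≠ 0 := Complex.exp_ne_zero _
  show S τ / Function.Periodic.qParam 1 (τ : ℂ) ^ m * Function.Periodic.qParam 1 (τ : ℂ) ^ m = S τ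
  rw [div_mul_cancel₀ _ (pow_ne_zero _ hq)]

/-- **Cuspidal Sturm bound at level `56`, weight `2`: `S ∈ S₂(Γ₀(56))` with `S/q¹⁰` convergent at `i∞` vanishes** (`⌊2·96/12⌋ + 1 = 17 < 10 + 8`).
[cite: DiamondShurman2005, Thm. 3.5.1] -/
theorem cuspForm_two_fiftySix_eq_zero_of_tendsto (S : CuspForm (Gamma0 56) 2) {c : ℂ}
    (h : Tendsto (fun τ : ℍ ↦ S τ / Function.Periodic.qParam 1 (τ : ℂ) ^ 10) atImInfty (𝓝 c)) : S = 0 := by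
  have h0 := coe_eq_zero_of_isBigO_exp S (isBigO_exp_of_tendsto_div_qParam_pow S 10 h) (by
    rw [sturm_data_56.1, sturm_data_56.2]
    simp only [Int.reduceMul, Int.reduceToNat, Nat.reduceDiv, Nat.cast_ofNat]
    norm_num)
  exact DFunLike.ext' (h0.trans CuspForm.coe_zero.symm)

/-- **Cuspidal Sturm bound at level `56`, weight `4`: `S ∈ S₄(Γ₀(56))` with `S/q²⁶` convergent at `i∞` vanishes** (`⌊4·96/12⌋ + 1 = 33 < 26 + 8`).
[cite: DiamondShurman2005, Thm. 3.5.1] -/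
theorem cuspForm_four_fiftySix_eq_zero_of_tendsto (S : CuspForm (Gamma0 56) 4) {c : ℂ}
    (h : Tendsto (fun τ : ℍ ↦ S τ / Function.Periodic.qParam 1 (τ : ℂ) ^ 26) atImInfty (𝓝 c)) : S = 0 := by
  have h0 := coe_eq_zero_of_isBigO_exp S (isBigO_exp_of_tendsto_div_qParam_pow S 26 h) (by
    rw [sturm_data_56.1, sturm_data_56.2]
    simp only [Int.reduceMul, Int.reduceToNat, Nat.reduceDiv, Nat.cast_ofNat]
    norm_num)
  exact DFunLike.ext' (h0.trans CuspForm.coe_zero.symm)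

end Summit.BirchSwinnertonDyer.BirchSwinnertonDyer.Theorems.ManinLocalTwoThree.NewformsFiftySix

end
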